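import Summits.ValiantsHypothesis.ValiantsHypothesis.Theorems.VPBoundarySquareNbPresSigma
import HarnessLib

/-!
# VP boundary square — `VNP` is closed under substitution-with-degree-control and under
truncation to `p`-bounded degree (decomp-valiant lens 3, O-L3-14 sequel S3, FILE 1/2)

FILE S3a of the lens-3 ladder `B_nb ≡ U_ε^Σ ≡ NF_ℂ` (aside `B_nb` = item 23487 =
`VNPnbPFamSubsetVNP ℂ`, Bürgisser 2024 Thm 4.10 (2)). FILE `…NbCollapseIff` proved
`B_nb ⟹ NF_ℂ` (every `VNPnb` family is a power substitution `z ↦ X_{v z}^{2^{ℓ z}}` of a `VNP`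
family) and FILE `…NbPresSigma` proved `U_ε^Σ ≡ B_nb`. The converse `NF_ℂ ⟹ B_nb` (FILE S3b,
`…NbNormalFormIff`) needs exactly two closure properties of `VNP` over a field of characteristic
zero, supplied here with no new definitions:

* §1 `totalDegree_aeval_le_mul`: `deg f(θ) ≤ D · deg f` when every `deg θ_i ≤ D`.
* §2 `isVNPFamily_aeval_mul` / `isVNPFamily_aeval`: if `(f_n) ∈ VNP`, `θ_n` is a substitution of
  `p`-bounded total size and `p`-bounded degree into `p`-boundedly many variables, and `q_n` is a
  `p`-bounded-size, `p`-bounded-degree factor, then `(f_n(θ_n) · q_n) ∈ VNP` — substitute into the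
  free variables of the Boolean sum (`boolSum_aeval_extend`, `boolSum_mul_rename_inl`), the
  witness stays in `VP` because BOTH size (`complexity_aeval_le`) and degree (§1) are controlled.
  (The unbounded-degree analogue `IsVNPnbFamily.aeval` of `Bur24PowerSubstitution` needs no degree
  bookkeeping; this is the bounded-degree version.)
* §3 `isVNPFamily_truncate`: if `(F_n) ∈ VNP` and `d` is `p`-bounded then the truncations
  `Σ_{j ≤ d_n} F_n^{(j)}` (homogeneous components of degree `≤ d_n`) form a `VNP` family. Proof:
  the scaling `x ↦ y·x` turns the degree grading into the `y`-grading,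
  `[y^{d}] (F(y·x) · (1 + y + ⋯ + y^{d})) = Σ_{j ≤ d} F^{(j)}` (`coeff_sumAlgEquiv_scale_mul_geom`,
  a polynomial identity proved monomial by monomial), the scaled family is in `VNP` by §2, and
  `VNP` is closed under taking coefficients (Bürgisser 2024 Prop. 3.1 = Valiant 1982,
  `IsVNPFamily.coeff`). This is the classical "VNP is closed under homogeneous components"
  (Bürgisser 2000, §2.1) routed through Prop. 3.1 instead of circuit homogenisation.

No `def`, no `def … : Prop`, no named facts, no `sorry`.

References: [cite: Burgisser2024Completeness, Prop. 3.1 (§3.1), §4.2 Cor. 4.7 / Thm. 4.10 (2)]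
[cite: Burgisser2000, §2.1] [cite: Valiant1982, §3] [folklore]
-/

set_option linter.dupNamespace false

noncomputable section

open MvPolynomial Finset
open Literature.Computability.AlgebraicComplexity
open Summit.ValiantsHypothesis.ValiantsHypothesis.Theorems.VPBoundarySquareNbBitSplit
open Summit.ValiantsHypothesis.ValiantsHypothesis.Theorems.VPBoundarySquareNbGRHSlot
open Summit.ValiantsHypothesis.ValiantsHypothesis.Theorems.VPBoundarySquareNbCollapseIff
open Summit.ValiantsHypothesis.ValiantsHypothesis.Theorems.VPBoundarySquareNbPresSigma

namespace Summit.ValiantsHypothesis.ValiantsHypothesis.Theorems.VPBoundarySquareNbTruncation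

universe u v

/-! ## §1. Degree of a substitution -/

section Degree

variable {R : Type*} [CommSemiring R] {σ τ : Type*}

/-- `deg f(θ) ≤ D · deg f` when `deg θ_i ≤ D` for the variables `i` OF `f`. Tree twins with the
hypothesis on all `i` (not imported, to keep the import cone EXACT; cited, not restated):
`Literature…VNPClosedUnderComposition.totalDegree_aeval_le_mul_of_le` (conclusion `deg f · δ`) and
`…Theorems.SymmetroidDescartesThetaPencilWitnessTheta.totalDegree_aeval_le_mul`. [folklore] -/
theorem totalDegree_aeval_le_mul (p : MvPolynomial σ R) (θ : σ → MvPolynomial τ R) {D : ℕ}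
    (h : ∀ i ∈ p.vars, (θ i).totalDegree ≤ D) :
    (aeval θ p).totalDegree ≤ D * p.totalDegree := by
  rw [aeval_def, eval₂_eq]
  refine totalDegree_finsetSum_le fun s hs => ?_
  calc (algebraMap R (MvPolynomial τ R) (coeff s p) * ∏ i ∈ s.support, θ i ^ s i).totalDegree
      ≤ (algebraMap R (MvPolynomial τ R) (coeff s p)).totalDegree +
          (∏ i ∈ s.support, θ i ^ s i).totalDegree := totalDegree_mul _ _
    _ ≤ 0 + ∑ i ∈ s.support, (θ i ^ s i).totalDegree := by
        rw [algebraMap_eq, totalDegree_C]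
        exact Nat.add_le_add_left (totalDegree_finsetProd _ _) _
    _ ≤ ∑ i ∈ s.support, D * s i := by
        rw [zero_add]
        refine Finset.sum_le_sum fun i hi => (totalDegree_pow _ _).trans ?_
        rw [mul_comm D]
        exact Nat.mul_le_mul_left _ (h i ((mem_vars_iff_mem_support i).mpr ⟨s, hs, hi⟩))
    _ = D * ∑ i ∈ s.support, s i := (Finset.mul_sum _ _ _).symm
    _ ≤ D * p.totalDegree := Nat.mul_le_mul_left _ (le_totalDegree hs)

end Degree

/-! ## §2. `VNP` is closed under `p`-bounded substitutions with degree control -/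

section Closure

variable {F : Type u} [Field F] {σ τ : ℕ → Type v} [∀ n, Fintype (σ n)] [∀ n, Fintype (τ n)]

/-- **`VNP` is closed under substitution-and-multiplication with size AND degree control**:
`(f_n) ∈ VNP`, `Σ_i L(θ_{n,i})`, `max_i deg θ_{n,i}`, `#τ_n`, `L(q_n)`, `deg q_n` all `p`-bounded
`⟹ (f_n(θ_n) · q_n)_n ∈ VNP` (witness: substitute into the free variables of the Boolean sum
and multiply by the `e`-free factor). Literature twins (NOT in the import closure of
`…NbPresSigma`; not imported, to keep the import cone EXACT): `IsVNPFamily.aeval`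
(`VNPClosedUnderComposition`, sup-form degree hypothesis, no multiplier) with `IsVNPFamily.mul`
(`VNPClosedUnderSum`) give this statement for a `VNP` multiplier `q`.
[cite: Burgisser2024Completeness, §3.1 (p0013 L10–L15, L39–L40), §4.2 (p0016 L20–L23)] -/
theorem isVNPFamily_aeval_mul {f : ∀ n, MvPolynomial (σ n) F} (hf : IsVNPFamily f)
    (θ : ∀ n, σ n → MvPolynomial (τ n) F) (q : ∀ n, MvPolynomial (τ n) F)
    (hτ : IsPBounded fun n => Fintype.card (τ n))
    (hθc : IsPBounded fun n => ∑ i, complexity (θ n i))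
    {D : ℕ → ℕ} (hD : IsPBounded D) (hθd : ∀ n i, (θ n i).totalDegree ≤ D n)
    (hqc : IsPBounded fun n => complexity (q n))
    (hqd : IsPBounded fun n => (q n).totalDegree) :
    IsVNPFamily fun n => aeval (θ n) (f n) * q n := by
  classical
  obtain ⟨⟨hvars, hdeg⟩, u, g, ⟨⟨gvars, gdeg⟩, gcx⟩, hfg⟩ := hf
  have hu : IsPBounded u := gvars.mono fun n => by simp [Fintype.card_sum]
  -- substitute into the free variables, keep the Boolean variables
  let θ' : ∀ n, (σ n ⊕ Fin (u n)) → MvPolynomial (τ n ⊕ Fin (u n)) F := fun n =>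
    Sum.elim (fun i => rename Sum.inl (θ n i)) (fun j => X (Sum.inr j))
  have hθ'd : ∀ n x, (θ' n x).totalDegree ≤ D n + 1 := by
    intro n x
    rcases x with i | j
    · exact (totalDegree_rename_le _ _).trans ((hθd n i).trans (Nat.le_succ _))
    · exact (mvPolynomial_totalDegree_X_le_one _).trans (Nat.le_add_left 1 (D n))
  have hθ'c : ∀ n, ∑ x, complexity (θ' n x) ≤ ∑ i, complexity (θ n i) := by
    intro n
    rw [Fintype.sum_sum_type]
    have h2 : ∑ j : Fin (u n), complexity (θ' n (Sum.inr j)) = 0 :=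
      Finset.sum_eq_zero fun j _ => complexity_X_holds _
    rw [h2, add_zero]
    exact Finset.sum_le_sum fun i _ => complexity_rename_le_holds' _ _
  refine ⟨⟨hτ, (IsPBounded.add_holds (IsPBounded.mul_holds hD hdeg) hqd).mono fun n =>
      (totalDegree_mul _ _).trans
        (Nat.add_le_add_right (totalDegree_aeval_le_mul _ _ fun i _ => hθd n i) _)⟩,
    u, fun n => aeval (θ' n) (g n) * rename Sum.inl (q n), ⟨⟨?_, ?_⟩, ?_⟩, fun n => ?_⟩
  · -- variables of the witness: `#τ_n + u_n`
    exact (IsPBounded.add_holds hτ hu).mono fun n => by simp [Fintype.card_sum]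
  · -- degree of the witness: `≤ (D_n + 1) · deg g_n + deg q_n`
    exact (IsPBounded.add_holds (IsPBounded.mul_holds (IsPBounded.add_holds hD (IsPBounded.const 1))
      gdeg) hqd).mono fun n => (totalDegree_mul _ _).trans
        (add_le_add (totalDegree_aeval_le_mul _ _ fun x _ => hθ'd n x) (totalDegree_rename_le _ _))
  · -- size of the witness: `≤ L(g_n) + Σ_i L(θ_{n,i}) + L(q_n) + 1`
    refine (IsPBounded.add_holds (IsPBounded.add_holds (IsPBounded.add_holds gcx hθc) hqc)
      (IsPBounded.const 1)).mono fun n => ?_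
    have h1 := (complexity_aeval_le (g n) (θ' n)).trans (Nat.add_le_add_left (hθ'c n) _)
    have h2 := complexity_rename_le_holds' (Sum.inl : τ n → τ n ⊕ Fin (u n)) (q n)
    have h3 := complexity_mul_le_holds (aeval (θ' n) (g n)) (rename Sum.inl (q n))
    exact h3.trans (by omega)
  · show aeval (θ n) (f n) * q n = boolSum (aeval (θ' n) (g n) * rename Sum.inl (q n))
    rw [boolSum_mul_rename_inl, hfg n, boolSum_aeval_extend]

/-- **`VNP` is closed under `p`-bounded substitutions with degree control** (`q = 1` in
`isVNPFamily_aeval_mul`) = Literature `IsVNPFamily.aeval` of `VNPClosedUnderComposition` up to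
hypothesis shape (there `IsPBounded (n ↦ sup_i deg θ_{n,i})`, here a named `p`-bounded `D`); not
imported, to keep the import cone EXACT. [cite: Burgisser2024Completeness, §3.1 (p0013 L10–L15)] -/
theorem isVNPFamily_aeval {f : ∀ n, MvPolynomial (σ n) F} (hf : IsVNPFamily f)
    (θ : ∀ n, σ n → MvPolynomial (τ n) F) (hτ : IsPBounded fun n => Fintype.card (τ n))
    (hθc : IsPBounded fun n => ∑ i, complexity (θ n i))
    {D : ℕ → ℕ} (hD : IsPBounded D) (hθd : ∀ n i, (θ n i).totalDegree ≤ D n) :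
    IsVNPFamily fun n => aeval (θ n) (f n) := by
  have h := isVNPFamily_aeval_mul hf θ (fun _ => 1) hτ hθc hD hθd
    ((IsPBounded.const 0).mono fun n => by
      show complexity (1 : MvPolynomial (τ n) F) ≤ 0
      rw [← C_1, complexity_C_holds])
    ((IsPBounded.const 0).mono fun n => by
      show (1 : MvPolynomial (τ n) F).totalDegree ≤ 0
      rw [totalDegree_one])
  simpa only [mul_one] using h

end Closure

/-! ## §3. Truncation to `p`-bounded degree -/

section Scale

variable {R : Type*} [CommSemiring R] {σ : Type*}

/-- `L(y^i) ≤ i`. [folklore] -/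
theorem complexity_X_pow_le_self {F : Type u} [Field F] {ρ : Type*} (y : ρ) (i : ℕ) :
    complexity ((X y : MvPolynomial ρ F) ^ i) ≤ i := by
  induction i with
  | zero => rw [pow_zero, ← C_1, complexity_C_holds]
  | succ i ih =>
    rw [pow_succ]
    have h := complexity_mul_le_holds ((X y : MvPolynomial ρ F) ^ i) (X y)
    rw [complexity_X_holds] at h
    omega

/-- `L(1 + y + ⋯ + y^d) ≤ (d + 1)²`. [folklore] -/
theorem complexity_geom_le {F : Type u} [Field F] {ρ : Type*} (y : ρ) (d : ℕ) :
    complexity (∑ i ∈ range (d + 1), (X y : MvPolynomial ρ F) ^ i) ≤ (d + 1) * (d + 1) := by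
  refine (complexity_finset_sum_le _ _).trans ?_
  have h : ∑ i ∈ range (d + 1), complexity ((X y : MvPolynomial ρ F) ^ i) ≤
      ∑ _i ∈ range (d + 1), d :=
    Finset.sum_le_sum fun i hi =>
      (complexity_X_pow_le_self y i).trans (Nat.lt_add_one_iff.mp (Finset.mem_range.mp hi))
  rw [Finset.sum_const, Finset.card_range, smul_eq_mul] at h
  rw [Finset.card_range]
  calc _ ≤ (d + 1) * d + (d + 1) := Nat.add_le_add_right h _
    _ = (d + 1) * (d + 1) := by ring

/-- The scaling `x_i ↦ y · x_i` on a monomial: `y^{|s|} · c x^s`, read in `(R[x])[y]`.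
[folklore] -/
theorem sumAlgEquiv_aeval_scale_monomial (s : σ →₀ ℕ) (c : R) :
    sumAlgEquiv R (Fin 1) σ (aeval (fun i : σ =>
        (X (Sum.inl 0) * X (Sum.inr i) : MvPolynomial (Fin 1 ⊕ σ) R)) (monomial s c)) =
      C (monomial s c) * X 0 ^ s.degree := by
  have hprod : (s.prod fun i e => ((X 0 : MvPolynomial (Fin 1) (MvPolynomial σ R)) * C (X i)) ^ e)
      = X 0 ^ s.degree * C (monomial s 1) := by
    rw [Finsupp.degree_apply, Finsupp.prod, ← prod_X_pow_eq_monomial, map_prod,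
      ← Finset.prod_pow_eq_pow_sum, ← Finset.prod_mul_distrib]
    exact Finset.prod_congr rfl fun i _ => by rw [mul_pow, map_pow]
  simp only [aeval_monomial, algebraMap_eq, map_mul, map_finsuppProd, map_pow, sumAlgEquiv_C_inl,
    sumAlgEquiv_X_inl, sumAlgEquiv_X_inr]
  rw [hprod, mul_left_comm, ← map_mul, C_mul_monomial, mul_one]
  exact mul_comm _ _

/-- **Truncation as a coefficient**: `[y^d] (P(y·x) · (1 + y + ⋯ + y^d)) = Σ_{j ≤ d} P^{(j)}`.
[folklore] -/
theorem coeff_sumAlgEquiv_scale_mul_geom (d : ℕ) (P : MvPolynomial σ R) :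
    coeff (Finsupp.single (0 : Fin 1) d) (sumAlgEquiv R (Fin 1) σ
      (aeval (fun i : σ => (X (Sum.inl 0) * X (Sum.inr i) : MvPolynomial (Fin 1 ⊕ σ) R)) P *
        ∑ i ∈ range (d + 1), (X (Sum.inl 0) : MvPolynomial (Fin 1 ⊕ σ) R) ^ i)) =
      ∑ j ∈ range (d + 1), homogeneousComponent j P := by
  classical
  have hS : sumAlgEquiv R (Fin 1) σ
      (∑ i ∈ range (d + 1), (X (Sum.inl 0) : MvPolynomial (Fin 1 ⊕ σ) R) ^ i) =
        ∑ i ∈ range (d + 1), (X 0 : MvPolynomial (Fin 1) (MvPolynomial σ R)) ^ i := by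
    simp only [map_sum, map_pow, sumAlgEquiv_X_inl]
  refine MvPolynomial.induction_on' P (fun s c => ?_) (fun p q hp hq => ?_)
  · -- a monomial `c x^s` of degree `N = |s|`: `[y^d] Σ_i c x^s y^{N+i} = [N ≤ d] c x^s`
    have hi : ∀ i : ℕ, coeff (Finsupp.single (0 : Fin 1) d)
        (C (monomial s c) * (X 0 : MvPolynomial (Fin 1) (MvPolynomial σ R)) ^ s.degree *
          X 0 ^ i) = if s.degree + i = d then monomial s c else 0 := by
      intro i
      rw [mul_assoc, ← pow_add, C_mul_X_pow_eq_monomial, coeff_monomial]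
      exact if_congr (Finsupp.single_injective _).eq_iff rfl rfl
    rw [map_mul, sumAlgEquiv_aeval_scale_monomial, hS, Finset.mul_sum, coeff_sum]
    by_cases hle : s.degree ≤ d
    · have hj : ∑ j ∈ range (d + 1), homogeneousComponent j (monomial s c) = monomial s c := by
        rw [Finset.sum_eq_single_of_mem s.degree (Finset.mem_range.mpr (by omega))
          (fun j _ hne => by
            rw [homogeneousComponent_of_mem (m := j) (isHomogeneous_monomial (d := s) c rfl),
              if_neg hne])]
        exact homogeneousComponent_eq_self (isHomogeneous_monomial (d := s) c rfl)
      rw [hj, Finset.sum_eq_single_of_mem (d - s.degree) (Finset.mem_range.mpr (by omega))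
        (fun i _ hne => by rw [hi, if_neg (by omega)]), hi, if_pos (by omega)]
    · have hj : ∑ j ∈ range (d + 1), homogeneousComponent j (monomial s c) = 0 :=
        Finset.sum_eq_zero fun j hj => by
          rw [homogeneousComponent_of_mem (m := j) (isHomogeneous_monomial (d := s) c rfl), if_neg]
          have := Finset.mem_range.mp hj
          omega
      rw [hj]
      exact Finset.sum_eq_zero fun i _ => by rw [hi, if_neg (by omega)]
  · -- additivity
    rw [map_add, add_mul, map_add, coeff_add, hp, hq, ← Finset.sum_add_distrib]
    exact Finset.sum_congr rfl fun j _ => (map_add _ _ _).symm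

end Scale

section Truncate

variable {F : Type u} [Field F] [CharZero F]

/-- **`VNP` is closed under truncation to `p`-bounded degree** (characteristic zero): if
`(F_n) ∈ VNP` and `d` is `p`-bounded then `(Σ_{j ≤ d_n} F_n^{(j)})_n ∈ VNP` — the scaling
`x ↦ y·x` (§2), the factor `1 + y + ⋯ + y^{d_n}`, and one coefficient extraction in `y`
(Bürgisser 2024 Prop. 3.1, `IsVNPFamily.coeff`; `coeff_sumAlgEquiv_scale_mul_geom`).
[cite: Burgisser2024Completeness, Prop. 3.1 (§3.1, p0013 L17–L26)] [cite: Burgisser2000, §2.1] -/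
theorem isVNPFamily_truncate {w : ℕ → ℕ} {f : ∀ n, MvPolynomial (Fin (w n)) F}
    (hf : IsVNPFamily f) {d : ℕ → ℕ} (hd : IsPBounded d) :
    IsVNPFamily fun n => ∑ j ∈ range (d n + 1), homogeneousComponent j (f n) := by
  have hw : IsPBounded w := hf.1.1.mono fun n => by simp
  have hG : IsVNPFamily fun n =>
      aeval (fun i : Fin (w n) =>
          (X (Sum.inl 0) * X (Sum.inr i) : MvPolynomial (Fin 1 ⊕ Fin (w n)) F)) (f n) *
        ∑ i ∈ range (d n + 1), (X (Sum.inl 0) : MvPolynomial (Fin 1 ⊕ Fin (w n)) F) ^ i := by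
    refine isVNPFamily_aeval_mul hf _ _
      ((IsPBounded.add_holds (IsPBounded.const 1) hw).mono fun n => by simp [Fintype.card_sum])
      (hw.mono fun n => ?_) (IsPBounded.const 2) (fun n i => ?_)
      ((IsPBounded.mul_holds (IsPBounded.add_holds hd (IsPBounded.const 1))
        (IsPBounded.add_holds hd (IsPBounded.const 1))).mono fun n => complexity_geom_le _ _)
      (hd.mono fun n => totalDegree_finsetSum_le fun i hi => by
        rw [totalDegree_X_pow]
        exact Nat.lt_add_one_iff.mp (Finset.mem_range.mp hi))
    · -- `Σ_i L(y · x_i) ≤ #x`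
      calc ∑ i : Fin (w n), complexity
            ((X (Sum.inl 0) : MvPolynomial (Fin 1 ⊕ Fin (w n)) F) * X (Sum.inr i))
          ≤ ∑ _i : Fin (w n), 1 := Finset.sum_le_sum fun i _ => by
              have h := complexity_mul_le_holds
                (X (Sum.inl (0 : Fin 1)) : MvPolynomial (Fin 1 ⊕ Fin (w n)) F) (X (Sum.inr i))
              rw [complexity_X_holds, complexity_X_holds] at h
              omega
        _ = w n := by simp
    · exact (totalDegree_mul _ _).trans (add_le_add (mvPolynomial_totalDegree_X_le_one _)
        (mvPolynomial_totalDegree_X_le_one _))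
  have hc := IsVNPFamily.coeff (a := fun _ => 1) (τ := fun n => Fin (w n)) hG
    fun n => Finsupp.single 0 (d n)
  refine (congrArg IsVNPFamily (funext fun n => ?_)).mp hc
  exact coeff_sumAlgEquiv_scale_mul_geom (d n) (f n)

end Truncate

end Summit.ValiantsHypothesis.ValiantsHypothesis.Theorems.VPBoundarySquareNbTruncation

end
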